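import Summits.KontsevichZagierPeriods.KontsevichZagierPeriods.Theorems.TerasomaMultiplicationMultiplicationAccessibleCancellationReduction

/-!
# `MultiplicationAccessible` (stmt-KontsevichZagierPeriods-12305), line `shifted-family-prime-sieve`:
the crux at every `n = 2^a·3^b` modulo `BetaCancellation`

Companion of `…CancellationReduction.lean`: with Beta cancellation (crux 4 of route
TerasomaMultiplication) the shifted family holds at `p = 3` (`gm_of_betaCancellation_of_at` + the
landed `MultiplicationThree`), hence at every `3^b` and — glued with the Sieve's unconditional family
at `2^a` (`gm_two_pow`, `gm_glue`) — at every `2^a·3^b`; the bridge at `x = 1/n`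
(`multiplicationAccessible_at_of_gm`) gives the crux instances. Unconditionally known so far:
`n = 2^k` (Sieve) and `n = 3·2^k` (Doubling). References: Andrews–Askey–Roy 1999, Thm 1.5.2.
-/

noncomputable section

open MeasureTheory Set Finset
open scoped BigOperators
open Literature.NumberTheory.Transcendental
open Literature.NumberTheory.Transcendental.KZ
open Summit.KontsevichZagierPeriods.MultiplicationAccessible.Negative (At at_zero)
open Summit.KontsevichZagierPeriods.KontsevichZagierPeriods.Theses.TerasomaMultiplication (BetaCancellation)

namespace Summit.KontsevichZagierPeriods.TerasomaMultiplication.MultiplicationAccessible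

/-- The shifted family at every `n = 3^b`, modulo `BetaCancellation`. [cite: AndrewsAskeyRoy1999, Thm 1.5.2] -/
theorem gm_three_pow_of_betaCancellation (hBC : BetaCancellation) : ∀ (b m : ℕ), m + 1 = 3 ^ b →
    (∀ (x s : ℚ), 0 < x → 0 < s → ∀ (r r' : IntegralRep (m + 1)),
        r.domain = {z | ∀ i, z i ∈ Set.Ioo (0:ℝ) 1} →
        Set.EqOn r.integrand (fun z => ∏ k : Fin (m + 1),
          (z k) ^ ((x:ℝ) + ((k:ℕ):ℝ) / ((m:ℝ) + 1) - 1) * (1 - z k) ^ ((s:ℝ) - 1)) r.domain →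
        r'.domain = {z | ∀ i, z i ∈ Set.Ioo (0:ℝ) 1} →
        Set.EqOn r'.integrand (fun z => ((m:ℝ) + 1) ^ (((m:ℝ) + 1) * (s:ℝ)) *
          ((z 0) ^ (((m:ℝ) + 1) * (x:ℝ) - 1) * (1 - z 0) ^ (((m:ℝ) + 1) * (s:ℝ) - 1)) *
          ∏ j : Fin m, (z j.succ) ^ ((((j:ℕ):ℝ) + 1) * (s:ℝ) - 1) * (1 - z j.succ) ^ ((s:ℝ) - 1))
          r'.domain →
        Equivalent r r') := by
  intro b
  induction b with
  | zero =>
    intro m hm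
    have : m = 0 := by simpa using hm
    subst this
    exact gm_zero
  | succ b ih =>
    intro m hm
    obtain ⟨m₀, hm₀⟩ : ∃ m₀, m₀ + 1 = 3 ^ b :=
      ⟨3 ^ b - 1, Nat.sub_add_cancel (Nat.one_le_pow _ _ (by norm_num))⟩
    have hm' : 2 * m₀ + 2 + m₀ = m := by
      have : m + 1 = 3 * (m₀ + 1) := by rw [hm, hm₀, pow_succ, mul_comm]
      omega
    rw [← hm']
    exact gm_glue 2 m₀ (gm_of_betaCancellation_of_at hBC 2 fun z hz => at_two hz) (ih m₀ hm₀)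

/-- **The crux at every `n = 2^a·3^b`, modulo `BetaCancellation`**: the shifted families at `2^a`
(Sieve) and `3^b` glue to `2^a·3^b`; then the bridge at `x = 1/n`. [cite: AndrewsAskeyRoy1999, Thm 1.5.2] -/
theorem multiplicationAccessible_at_smooth_of_betaCancellation :
    Summit.KontsevichZagierPeriods.KontsevichZagierPeriods.Theses.TerasomaMultiplication.BetaCancellation →
    ∀ (a b m : ℕ), m + 1 = 2 ^ a * 3 ^ b → ∀ (s : ℚ), 0 < s → ∀ (r r' : KZ.IntegralRep m),
      r.domain = {x | ∀ i, x i ∈ Set.Ioo (0:ℝ) 1} →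
      Set.EqOn r.integrand (fun x => ∏ i : Fin m,
        (x i) ^ ((((i:ℕ):ℝ) + 1) / ((m:ℝ) + 1) - 1) * (1 - x i) ^ ((s:ℝ) - 1)) r.domain →
      r'.domain = {x | (∀ i, 0 < x i) ∧ ∑ i, x i < (m:ℝ) + 1} →
      Set.EqOn r'.integrand
        (fun x => ((∏ i, x i) * ((m:ℝ) + 1 - ∑ i, x i)) ^ ((s:ℝ) - 1)) r'.domain →
      KZ.Equivalent r r' := by
  intro hBC a b m hm s hs r r' hd hi hd' hi'
  rcases Nat.eq_zero_or_pos m with rfl | hmpos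
  · exact at_zero s r r' ⟨hd, hi⟩ ⟨hd', hi'⟩
  obtain ⟨m₂, hm₂⟩ : ∃ m₂, m₂ + 1 = 2 ^ a := ⟨2 ^ a - 1, Nat.sub_add_cancel Nat.one_le_two_pow⟩
  obtain ⟨m₃, hm₃⟩ : ∃ m₃, m₃ + 1 = 3 ^ b :=
    ⟨3 ^ b - 1, Nat.sub_add_cancel (Nat.one_le_pow _ _ (by norm_num))⟩
  have hm' : m₂ * m₃ + m₂ + m₃ = m := by
    have : m + 1 = (m₂ + 1) * (m₃ + 1) := by rw [hm, hm₂, hm₃]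
    have : m = m₂ * m₃ + m₂ + m₃ := by
      have h := this; ring_nf at h ⊢; omega
    omega
  have hGM := gm_glue m₂ m₃ (gm_two_pow a m₂ hm₂) (gm_three_pow_of_betaCancellation hBC b m₃ hm₃)
  rw [hm'] at hGM
  exact multiplicationAccessible_at_of_gm m s hmpos hs (hGM (1 / ((m:ℚ) + 1)) s (by positivity) hs)
    r r' hd hi hd' hi'

end Summit.KontsevichZagierPeriods.TerasomaMultiplication.MultiplicationAccessible

end
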